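import Summits.BirchSwinnertonDyer.Rank1Residual.X2.NonsplitControl
import Summits.BirchSwinnertonDyer.Rank1Residual.X2.RankOneChain
import Summits.BirchSwinnertonDyer.Rank1Residual.X2.ClassClosureO9
import Summits.BirchSwinnertonDyer.Rank1Residual.X11b.AnticyclotomicLogLinks
import Summits.BirchSwinnertonDyer.Rank1Residual.X11b.TamagawaHeegnerExact
import HarnessLib

/-!
# O9 sub-cell `CellCNonsplitNotGV` (X2c, NON-SPLIT `p`, ψ even): the (CTL) and (TAM) links of
# `X2/RankOneLinks` DISCHARGED — `BSD(E,p)` at a Heegner datum from published + cited facts and ONE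
# typed composite input (IMC∘BDP on the constructed `X_ac`) (cell `bsd-eis`, seat `bsd-eis-cgshw`;
# TARGET §6.2, brick 5)

HONEST FRAMING (cell `bsd-eis`): theorems only; nothing booked; X2 stays CONSTRUCTION-SHAPED. The O9
rank-one chain of the eisenstein-p2 seats (`X2/RankOneChain.lean`,
`bsdp_of_cellC_of_not_gvPar_of_shadowLinks`) takes, at a Heegner datum of a ψ-even X2c pair, a
`Λ`-adic SHADOW with four links (IMC) [Keller–Yin Thm. D = v1 5.0.4, PREPRINT], (BDP) [Castella's
`p`-adic Waldspurger value at `p ‖ N`], (CTL) [control with torsion — "assembled nowhere"], (TAM)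
[vacuous at a Heegner field]. At a NON-SPLIT `p` this file supplies (CTL) as the THEOREM of
`X2/NonsplitControl.lean` (no torsion: `E(ℚ_p)[p] = 0`; no irreducibility) and (TAM) by
`X11b.tamagawaProductSplit_eq_tamagawaProduct_of_heegner`, leaving ONE typed input on tree objects:
`X11b.IMCWaldspurgerOnTreeAt p κ 𝔭 γ (embAt K p 𝔭) P` — "`ord_p f_ac(0) = 2(ord_p log_ω P − 1)` for a
generator `f_ac` of `char Λ (X_ac(E[p^∞]))`" = (IMC)∘(BDP) at `𝟙` (Keller–Yin Thm. D ∘ Castella's value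
formula; bsd-eis-lit 2026-08-25: at a NON-split `p ∣ N` the value formula has no printed source —
[cas-split] is split-only — so BOTH factors of this composite are outside print today). Result:
`bsdp_of_cellCNonsplitNotGV_of_imcWaldspurgerOnTree`. CONDITIONAL on that input, on the five cited
cohomological facts of the X11b control chain, and on the published facts of `X2/RankOneChain.lean`.

References: [KellerYin2024] Thm. D (v2 = 5.1.3), App. B; [Castella2018] Thm. 2.3, Thm. 3.2, §5;
[JetchevSkinnerWan2017] Thm. 3.3.1; [CastellaEtAl2021] Thm. 5.3.1; [Miller2011LMS] Def. 1.1.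
-/

set_option autoImplicit false

noncomputable section

open scoped Classical MatrixGroups ModularForm

open CongruenceSubgroup WeierstrassCurve NumberField IsDedekindDomain Field
  Literature.NumberTheory.EllipticCurves Literature.NumberTheory.EllipticCurves.GreenbergSelmer
  Literature.NumberTheory.EllipticCurves.ModularForms
  Literature.NumberTheory.EllipticCurves.Rank1Residual
  Literature.NumberTheory.EllipticCurves.Rank1Residual.Typed
  Literature.NumberTheory.EllipticCurves.GreenbergVatsal2000
  Literature.NumberTheory.EllipticCurves.Wuthrich2014
  Literature.NumberTheory.EllipticCurves.SteinWuthrich2013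
  Literature.NumberTheory.GaloisRepresentations Literature.NumberTheory.GaloisCohomology
  Literature.NumberTheory.Automorphic
  Summit.BirchSwinnertonDyer.Rank1Residual.X11b.AcSelmer
  Summit.BirchSwinnertonDyer.Rank1Residual.X11b

namespace Summit.BirchSwinnertonDyer.Rank1Residual.X2

/-- **The four shadow links from the two tree-object links at a Heegner field** (X2 twin of
`X11b.shadow_of_onTreeLinks`, with (TAM) from the Heegner hypothesis for `N_E` instead of (TAM-q)):
(IMC∘BDP)@`𝟙` and (CTL) on the constructed `X_ac` at the same `(κ, γ, 𝔭, ι)` give a shadow `S` with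
`S.IMCAtTrivialChar ∧ S.WaldspurgerAt ∧ S.ControlAt p ∧ S.TamagawaAtRamifiedAt p` (the two generators'
`ord_p f(0)` agree by `XAc.HasCharValuationAt.unique`; `∏_{w∣N⁺} c_w = ∏_w c_w(E/K)` exactly at a
Heegner field, `X11b.tamagawaProductSplit_eq_tamagawaProduct_of_heegner`). Bookkeeping.
[cite: Castella2018, §5 (5.1)–(5.3) (arXiv:1704.06608 p. 12)] -/
theorem exists_shadowLinks_of_onTree_of_heegner {W : WeierstrassCurve ℚ} [W.IsElliptic]
    [W.IsGloballyMinimal] {K : Type} [Field K] [NumberField K] (p : ℕ) [Fact p.Prime]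
    (κ : ZpExtension K p) (𝔭 : HeightOneSpectrum (𝓞 K)) (γ : absoluteGaloisGroup K)
    [Fact (κ.IsTopGenerator γ)] (ι : K →+* ℚ_[p]) {P : (W.baseChange K).toAffine.Point}
    {N : ℕ} (hN : W.conductorNorm ℤ = N) (hH : SatisfiesHeegnerHypothesis N K)
    (hIW : IMCWaldspurgerOnTreeAt p κ 𝔭 γ ι P) (hCTL : ControlOnTreeAt p κ 𝔭 γ ι P) :
    ∃ S : X11b.LambdaAdicShadow W K P,
      S.IMCAtTrivialChar ∧ S.WaldspurgerAt ∧ S.ControlAt p ∧ S.TamagawaAtRamifiedAt p := by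
  obtain ⟨n, hn, hne⟩ := hIW
  obtain ⟨n', hn', hne'⟩ := hCTL
  obtain rfl : n = n' := hn.unique hn'
  refine ⟨⟨n, 2 * (padicLogOrd W p ι P - 1), padicLogOrd W p ι P,
    padicValNat p (tamagawaProductSplit W K)⟩, hne, rfl, hne', ?_⟩
  show ((padicValNat p (tamagawaProductSplit W K) : ℕ) : ℤ) =
    padicValNat p (W.baseChange K).tamagawaProduct
  rw [tamagawaProductSplit_eq_tamagawaProduct_of_heegner W K hN hH]

/-- **O9 sub-cell `CellCNonsplitNotGV` at a Heegner datum: `BSD(E,p)` with (CTL) and (TAM) DISCHARGED.**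
For a rank-one X2 pair at a NON-SPLIT `p` with `¬GVPar` (ψ even; partner in the CLOSED sub-cell X2a),
a CGLS/Heegner field `K` (`d_K < −4`, every prime of `N = N_E` and `p` split, `L(E^{(d_K)},1) ≠ 0`),
a parametrisation datum `Dt` with `p ∤ c` and its Heegner point `P` (non-torsion, `hPinf`), a globally
minimal twist model with the two decidable transport values, the Tamagawa-over-`K` value, an
anticyclotomic `κ` with topological generator `γ` and a degree-one `𝔭 ∣ p`: `BSD(E,p)` follows from the
PUBLISHED facts of `X2/RankOneChain.lean`, GZK/modularity, the FIVE cited cohomological facts of the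
X11b control chain (`hPT`, `hPT2`, `hEP`, `hcd`, `hBr`) and the ONE typed composite input
`hIW : IMCWaldspurgerOnTreeAt p κ 𝔭 γ (embAt K p 𝔭) P` ((IMC) Keller–Yin Thm. D ∘ (BDP) Castella's
value formula at `p ‖ N`, both unrefereed/unprinted at a non-split `p`). The control theorem is
`controlOnTreeAt_of_cellC_of_not_split`. CONDITIONAL; nothing booked.
[claim: KellerYin2024, status: under-review] [cite: CastellaEtAl2021, Thm. 5.3.1]
[cite: Castella2018, Thm. 2.3 and §5 (5.1)–(5.3)] [cite: Miller2011LMS, Def. 1.1] -/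
theorem bsdp_of_cellCNonsplitNotGV_of_imcWaldspurgerOnTree
    (hGV : lambdaMu_multiplicative_of_gvPar) (hWu : thm16_charIdeal_dvd_multiplicative_of_reducible)
    (hJs : thm61_splitMultiplicative) (hJn : thm61_nonsplitMultiplicative)
    (hHs : exists_isSplitMultCanonical) (hHn : exists_isMultCanonical)
    (hpar : nonempty_modularParametrizationData)
    (hGS : ∀ (W : WeierstrassCurve ℚ) [W.IsElliptic] [W.IsGloballyMinimal] (p : ℕ) [Fact p.Prime],
      greenberg_stevens (W := W) (p := p))
    (hnf : exists_isNewformOf)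
    (hPT : ∀ (K : Type) [Field K] [NumberField K], poitouTate_selmerStructure_duality K)
    (hPT2 : ∀ (K : Type) [Field K] [NumberField K], poitouTate_sha_tateDual K)
    (hEP : ∀ (K : Type) [Field K] [NumberField K] (v : HeightOneSpectrum (𝓞 K)),
      localEulerPoincareCharacteristic (v.adicCompletion K))
    (hcd : fieldCdLE_two_of_numberField)
    (hBr : ∀ (K : Type) [Field K] [NumberField K] (p : ℕ) [Fact p.Prime],
      ZpExtension.decomp_not_le_kerSubgroup_of_isAnticyclotomic K p)
    (W : WeierstrassCurve ℚ) [W.IsElliptic] [W.IsGloballyMinimal] (p : ℕ) [Fact p.Prime]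
    (N : ℕ) [NeZero N] (K : Type) [Field K] [NumberField K]
    (Dt : ModularParametrizationData W N) (H : HeegnerDatum N (NumberField.discr K)) (ι : K →+* ℂ)
    (P : (W.baseChange K).toAffine.Point)
    (hGZ : gross_zagier N W K) (hKo : kolyvagin N W K)
    (hGZK : rank_eq_analyticRank_of_analyticRank_le_one)
    (hc : CellCNonsplitNotGV W p) (hN : W.conductorNorm ℤ = N) (hK : IsImaginaryQuadratic K)
    (hd4 : NumberField.discr K < -4) (hHN : SatisfiesHeegnerHypothesis N K)
    (hsplit : SatisfiesHeegnerHypothesis p K)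
    (hP : WeierstrassCurve.Affine.Point.map ι.toRatAlgHom P = heegnerPointComplex Dt H)
    (hPinf : ¬ IsOfFinAddOrder P) (hcM : ¬ (p : ℤ) ∣ Dt.c)
    (hLt : (W.quadraticTwist (NumberField.discr K : ℚ)).entireLFunction 1 ≠ 0)
    (Wd : WeierstrassCurve ℚ) [Wd.IsElliptic] [Wd.IsGloballyMinimal] (Cd : VariableChange ℚ)
    (hWd : Cd • W.quadraticTwist (NumberField.discr K : ℚ) = Wd)
    (htam : padicValNat p Wd.tamagawaProduct = padicValNat p W.tamagawaProduct)
    (hu : padicValRat p (Cd.u : ℚ) = 0)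
    (htamK : padicValNat p (W.baseChange K).tamagawaProduct = 2 * padicValNat p W.tamagawaProduct)
    (κ : ZpExtension K p) (hκ : κ.IsAnticyclotomic) (γ : absoluteGaloisGroup K)
    [Fact (κ.IsTopGenerator γ)] (𝔭 : HeightOneSpectrum (𝓞 K))
    (h𝔭 : ((p : ℕ) : 𝓞 K) ∈ 𝔭.asIdeal) (he : 𝔭.asIdeal.ramificationIdx (𝓞 ℚ) = 1)
    (hf : 𝔭.asIdeal.inertiaDeg (𝓞 ℚ) = 1)
    (hIW : IMCWaldspurgerOnTreeAt p κ 𝔭 γ (embAt K p 𝔭 h𝔭 he hf) P) : BSDp W p := by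
  have hmod : hasEntireLFunction_rat := hasEntireLFunction_rat_of_exists_isNewformOf hnf
  have hCTL : ControlOnTreeAt p κ 𝔭 γ (embAt K p 𝔭 h𝔭 he hf) P :=
    controlOnTreeAt_of_cellC_of_not_split W p hGZK hnf hPT hPT2 hEP hcd hBr hc.1 hc.2.1 hK hsplit hLt P
      hPinf κ hκ γ 𝔭 h𝔭 he hf
  obtain ⟨S, hIMC, hBDP, hCTL', hTAM⟩ :=
    exists_shadowLinks_of_onTree_of_heegner p κ 𝔭 γ (embAt K p 𝔭 h𝔭 he hf) hN hHN hIW hCTL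
  exact bsdp_of_cellC_of_not_gvPar_of_shadowLinks hGV hWu hJs hJn hHs hHn hpar hGS W p N K Dt H ι P hGZ
    hKo hGZK hmod hc.1 hc.2.2 hK hd4 hHN hsplit hP hcM hLt Wd Cd hWd htam hu S hIMC hBDP hCTL' hTAM htamK

/-- **O9 ∩ {non-split}, EITHER parity, at a Heegner datum: `BSD(E,p)` with (CTL) and (TAM)
DISCHARGED, from the typed composite input and the PARTNER's rank-zero print shape.** As
`bsdp_of_cellCNonsplitNotGV_of_imcWaldspurgerOnTree` but for any `CellC` pair at a NON-SPLIT `p`, the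
partner input being explicit: `htw : PPartRankZero Wd p` for a globally minimal model `Wd` of
`E^{(d_K)}` (a rank-`0` X2 pair, NON-SPLIT at `p` by `hasSplitMultiplicativeReductionAtPrime_iff_of_smul_eq_quadraticTwist`;
on `¬GVPar` pairs it is the CLOSED sub-cell X2a, on `GVPar` pairs it is X2b ∩ {non-split}, i.e.
`X2.MazurMainConjectureAt Wd p` via `bsdp_of_mazurMainConjectureAt_of_analyticRank_eq_zero` — the output
of the higher-weight transfer `X2/HigherWeightEisensteinTransfer.lean`). Chain: control theorem
(`controlOnTreeAt_of_cellC_of_not_split`) + (IMC∘BDP)@`𝟙` ⟹ shadow links ⟹ Heegner-index identity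
(`indexIdentityAt_of_shadowLinks`) ⟹ `bsdp_of_cellC_of_indexIdentityAt`. CONDITIONAL; nothing booked.
[claim: KellerYin2024, status: under-review] [cite: CastellaEtAl2021, Thm. 5.3.1]
[cite: Castella2018, Thm. 2.3 and §5 (5.1)–(5.3)] [cite: Miller2011LMS, Def. 1.1] -/
theorem bsdp_of_cellC_of_not_split_of_imcWaldspurgerOnTree_of_partner
    (hnf : exists_isNewformOf)
    (hPT : ∀ (K : Type) [Field K] [NumberField K], poitouTate_selmerStructure_duality K)
    (hPT2 : ∀ (K : Type) [Field K] [NumberField K], poitouTate_sha_tateDual K)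
    (hEP : ∀ (K : Type) [Field K] [NumberField K] (v : HeightOneSpectrum (𝓞 K)),
      localEulerPoincareCharacteristic (v.adicCompletion K))
    (hcd : fieldCdLE_two_of_numberField)
    (hBr : ∀ (K : Type) [Field K] [NumberField K] (p : ℕ) [Fact p.Prime],
      ZpExtension.decomp_not_le_kerSubgroup_of_isAnticyclotomic K p)
    (W : WeierstrassCurve ℚ) [W.IsElliptic] [W.IsGloballyMinimal] (p : ℕ) [Fact p.Prime]
    (N : ℕ) [NeZero N] (K : Type) [Field K] [NumberField K]
    (Dt : ModularParametrizationData W N) (H : HeegnerDatum N (NumberField.discr K)) (ι : K →+* ℂ)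
    (P : (W.baseChange K).toAffine.Point)
    (hGZ : gross_zagier N W K) (hKo : kolyvagin N W K)
    (hGZK : rank_eq_analyticRank_of_analyticRank_le_one)
    (hc : CellC W p) (hns : ¬ W.HasSplitMultiplicativeReductionAtPrime p) (hN : W.conductorNorm ℤ = N)
    (hK : IsImaginaryQuadratic K) (hd4 : NumberField.discr K < -4)
    (hHN : SatisfiesHeegnerHypothesis N K) (hsplit : SatisfiesHeegnerHypothesis p K)
    (hP : WeierstrassCurve.Affine.Point.map ι.toRatAlgHom P = heegnerPointComplex Dt H)
    (hPinf : ¬ IsOfFinAddOrder P) (hcM : ¬ (p : ℤ) ∣ Dt.c)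
    (hLt : (W.quadraticTwist (NumberField.discr K : ℚ)).entireLFunction 1 ≠ 0)
    (Wd : WeierstrassCurve ℚ) [Wd.IsElliptic] [Wd.IsGloballyMinimal] (Cd : VariableChange ℚ)
    (hWd : Cd • W.quadraticTwist (NumberField.discr K : ℚ) = Wd) (htw : PPartRankZero Wd p)
    (htam : padicValNat p Wd.tamagawaProduct = padicValNat p W.tamagawaProduct)
    (hu : padicValRat p (Cd.u : ℚ) = 0)
    (htamK : padicValNat p (W.baseChange K).tamagawaProduct = 2 * padicValNat p W.tamagawaProduct)
    (κ : ZpExtension K p) (hκ : κ.IsAnticyclotomic) (γ : absoluteGaloisGroup K)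
    [Fact (κ.IsTopGenerator γ)] (𝔭 : HeightOneSpectrum (𝓞 K))
    (h𝔭 : ((p : ℕ) : 𝓞 K) ∈ 𝔭.asIdeal) (he : 𝔭.asIdeal.ramificationIdx (𝓞 ℚ) = 1)
    (hf : 𝔭.asIdeal.inertiaDeg (𝓞 ℚ) = 1)
    (hIW : IMCWaldspurgerOnTreeAt p κ 𝔭 γ (embAt K p 𝔭 h𝔭 he hf) P) : BSDp W p := by
  have hmod : hasEntireLFunction_rat := hasEntireLFunction_rat_of_exists_isNewformOf hnf
  have hCTL : ControlOnTreeAt p κ 𝔭 γ (embAt K p 𝔭 h𝔭 he hf) P :=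
    controlOnTreeAt_of_cellC_of_not_split W p hGZK hnf hPT hPT2 hEP hcd hBr hc hns hK hsplit hLt P
      hPinf κ hκ γ 𝔭 h𝔭 he hf
  obtain ⟨S, hIMC, hBDP, hCTL', hTAM⟩ :=
    exists_shadowLinks_of_onTree_of_heegner p κ 𝔭 γ (embAt K p 𝔭 h𝔭 he hf) hN hHN hIW hCTL
  exact bsdp_of_cellC_of_indexIdentityAt W p N K Dt H ι P hGZ hKo hGZK hmod hc hK hd4 hHN hP hcM hLt
    Wd Cd hWd htw htam hu
    (fun hfin => by
      haveI := hfin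
      exact indexIdentityAt_of_shadowLinks p S hIMC hBDP hCTL' hTAM htamK)

end Summit.BirchSwinnertonDyer.Rank1Residual.X2

end
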